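import Summits.QuantumFields.QCD.Theses.HeatSlicedQuarks
import Summits.QuantumFields.QCD.Theorems.RobustYangMillsHandover.Negative.ChiralityObstruction
import Summits.QuantumFields.QCD.Theorems.HeatSlicedQuarksRobustYangMillsHandoverSplit

/-!
# Strategy census s6 (independent family `s`) — kernel-checked skeleton of the headings

Crux `stmt-QuantumFields-8892`, `HeatSlicedQuarks.RobustYangMillsHandover := ContinuumQCDExists → QCD`.
Companion to `STRATEGY-CENSUS-s6.md`.  Everything here is elementary logic over the tree's definitions;
nothing asserts a Theses decl.  Sections follow the census headings:

* §1 WEAKER INTERMEDIATE — the crux is the WEAKEST statement completing the route's `closes` given the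
  X₀-chain (`completes_iff`): no strictly weaker replacement exists; the strictly weaker CONSEQUENCES
  (e.g. the heavy handover `X₀ → ThresholdQCD`, `heavyHandover_of_crux`) need a complement, i.e. §2.
* §2 DECOMPOSITION — the honest typed split is already landed (`Split.RobustYangMillsHandover_of_subs`,
  p140732); `qcd_latticeGapProfile` records the irreducible lattice content every piece-set must produce.
* §4 STRENGTHEN — the natural rigid form `RigidSupply` (every honest X₀-witness is ALREADY chiral and
  gapped) feeds the crux (`crux_of_rigidSupply`) but is inconsistent with any honest trajectory carrying
  a uniform lattice rate above a heavy threshold (`not_rigidSupply_of_uniformlyGappedAbove`): the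
  rigidity must re-pin `m_crit`, and then it is the sibling item `HeavyThresholdYMBridge.ChiralCompletion`.
* §5 NEGATION — `¬ crux ↔ X₀ ∧ ¬ QCD`, and `¬ QCD` is a universal statement over regularisations.
-/

namespace Summit.QuantumFields.QCD.Cruxes.RobustYangMillsHandover.CensusS6

open Summit.QuantumFields.QCD.Theses.HeatSlicedQuarks
open Summit.QuantumFields.QCD.Theorems.RobustYangMillsHandover
open Literature.MathematicalPhysics.QuantumFieldTheory

variable {Nf : ℕ}

/-! ## §1 Weaker intermediate: the crux is the weakest completion of `closes` -/

/-- Any statement `C'` that completes the route given X₀ implies the crux. [folklore] -/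
theorem weakest_completion (C' : Prop) (h : ContinuumQCDExists → C' → _root_.QCD) :
    C' → RobustYangMillsHandover := fun hc hX => h hX hc

/-- `C'` completes the route given X₀ iff `C'` implies the crux: the crux is the minimum of the
completions (Heyting residual `X₀ ⇨ QCD`). [folklore] -/
theorem completes_iff (C' : Prop) :
    (ContinuumQCDExists → C' → _root_.QCD) ↔ (C' → RobustYangMillsHandover) :=
  ⟨weakest_completion C', fun h hX hc => h hc hX⟩

/-- The threshold body of `QCDOf` above an offset `M₀ ≥ 0` (= the body of the sibling target
`HeavyThresholdYMBridge.ThresholdQCD` at this `N_f`, verbatim). -/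
def ThresholdBody (Nf : ℕ) : Prop :=
  ∃ M₀ : ℝ, 0 ≤ M₀ ∧ ∃ reg : QCDRegularisation Nf, reg.HasMassScaling ∧
    ∀ m : Fin Nf → ℝ, (∀ f, M₀ < m f) →
      ∃ (z shift : QCDField Nf → ℕ → ℝ) (T : OSData (QCDField Nf) 4),
        IsQCDAlong (reg.scheme m z shift) T ∧ T.IsNontrivial QCDField.glue ∧
          T.IsNonGaussian QCDField.glue ∧
            (∀ f g : Fin Nf, f ≠ g → T.IsNontrivial (QCDField.pseudoRe f g)) ∧
              ∃ Δ > 0, T.HasMassGap Δ ∧ (reg.scheme m z shift).HasLatticeMassGap Δ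

/-- The pre-re-type crux ("heavy handover"): X₀ hands over THRESHOLD QCD. -/
def HeavyHandover : Prop :=
  ContinuumQCDExists → ∀ Nf : ℕ, Nf = 2 ∨ Nf = 3 → ThresholdBody Nf

/- It is literally `X₀ → HeavyThresholdYMBridge.ThresholdQCD` (sibling target 8794):
`example : HeavyHandover ↔ (ContinuumQCDExists → Summit.QuantumFields.QCD.Theses.HeavyThresholdYMBridge.ThresholdQCD) := Iff.rfl`
kernel-checked in the folder copy `CensusS6-full.lean` (lean check rc 0, 2026-08-17); the import of the sibling route
module is dropped here only because that module was being rebuilt on the farm at publication time. -/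

/-- The heavy handover is a CONSEQUENCE of the crux (a strictly-weaker intermediate in the only
available sense: `QCDOf N_f` implies its threshold form with `M₀ = 0`); it completes the route only
together with a complement `ThresholdQCD → QCD` (the sibling item
`HeavyThresholdYMBridge.ChiralCompletion`, same-regularisation form). [folklore] -/
theorem heavyHandover_of_crux : RobustYangMillsHandover → HeavyHandover := by
  intro h hX Nf hNf
  obtain ⟨h2, h3⟩ := h hX
  rcases hNf with rfl | rfl
  · exact Negative.qcdOf_imp_aboveThreshold h2
  · exact Negative.qcdOf_imp_aboveThreshold h3

/-! ## §2 Decomposition: the landed split and the irreducible lattice content -/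

/-- The honest typed split of the tree, by name (p140732). -/
example := @Split.RobustYangMillsHandover_of_subs

/-- What every decomposition must produce on the LATTICE side, whatever the pieces: from X₀ (no spectral
datum at all) a mass-scaling, chiral-at-zero `SU(3)` Wilson trajectory whose lattice theories are
uniformly gapped at EVERY positive renormalised mass tuple — heavy tuples included, where the low-lying
spectrum is pure glue — and with NO uniform rate (the chiral regime is inside). [folklore] -/
theorem crux_latticeGapProfile (h : RobustYangMillsHandover) (hX : ContinuumQCDExists)
    (hNf : Nf = 2 ∨ Nf = 3) :
    ∃ reg : QCDRegularisation Nf, reg.HasMassScaling ∧ reg.IsChiralAtZero ∧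
      (∀ m : Fin Nf → ℝ, (∀ f, 0 < m f) → ∃ Δ > 0, (reg.scheme m 0 0).HasLatticeMassGap Δ) ∧
      ¬ ∃ ε > (0 : ℝ), ∀ m : Fin Nf → ℝ, (∀ f, 0 < m f) → (reg.scheme m 0 0).HasLatticeMassGap ε := by
  obtain ⟨h2, h3⟩ := h hX
  rcases hNf with rfl | rfl
  · exact Negative.qcdOf_gap_profile h2
  · exact Negative.qcdOf_gap_profile h3

/-! ## §4 Strengthen: the shift-free rigid supply and why it must re-pin -/

/-- The body X₀ asks of a regularisation (honest continuum data at every positive tuple). -/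
def X0Body (reg : QCDRegularisation Nf) : Prop :=
  ∀ m : Fin Nf → ℝ, (∀ f, 0 < m f) →
    ∃ (z shift : QCDField Nf → ℕ → ℝ) (T : OSData (QCDField Nf) 4),
      IsQCDAlong (reg.scheme m z shift) T ∧ T.IsNontrivial QCDField.glue ∧
        T.IsNonGaussian QCDField.glue ∧ ∀ f g : Fin Nf, f ≠ g → T.IsNontrivial (QCDField.pseudoRe f g)

/-- The body `QCDOf` asks of a regularisation at positive tuples (data AND both gaps). -/
def QCDBody (reg : QCDRegularisation Nf) : Prop :=
  ∀ m : Fin Nf → ℝ, (∀ f, 0 < m f) →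
    ∃ (z shift : QCDField Nf → ℕ → ℝ) (T : OSData (QCDField Nf) 4),
      IsQCDAlong (reg.scheme m z shift) T ∧ T.IsNontrivial QCDField.glue ∧
        T.IsNonGaussian QCDField.glue ∧
          (∀ f g : Fin Nf, f ≠ g → T.IsNontrivial (QCDField.pseudoRe f g)) ∧
            ∃ Δ > 0, T.HasMassGap Δ ∧ (reg.scheme m z shift).HasLatticeMassGap Δ

/-- S⁺ (shift-free ∀-rigidity): EVERY honest X₀-witness is already chiral at zero and gapped at every
positive tuple.  The natural "∃ ↦ ∀" strengthening of the crux. -/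
def RigidSupply : Prop :=
  ∀ Nf : ℕ, Nf = 2 ∨ Nf = 3 → ∀ reg : QCDRegularisation Nf, reg.HasMassScaling → X0Body reg →
    reg.IsChiralAtZero ∧ QCDBody reg

/-- S⁺ feeds the crux (so it would feed `closes`). [folklore] -/
theorem crux_of_rigidSupply (h : RigidSupply) : RobustYangMillsHandover := by
  intro hX
  have key : ∀ Nf, Nf = 2 ∨ Nf = 3 → QCDOf Nf := by
    intro Nf hNf
    obtain ⟨reg, hMS, hbody⟩ := hX Nf hNf
    obtain ⟨hχ, hq⟩ := h Nf hNf reg hMS hbody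
    exact ⟨reg, hMS, hχ, hq⟩
  exact (⟨key 2 (Or.inl rfl), key 3 (Or.inr rfl)⟩ : QCDOf 2 ∧ QCDOf 3)

/-- The `m_crit`-shift of a regularisation by an offset `M₀`. -/
noncomputable def shiftReg (reg : QCDRegularisation Nf) (M₀ : ℝ) : QCDRegularisation Nf :=
  { reg with mcrit := fun k => reg.mcrit k + reg.a k * M₀ / reg.Zm k }

/-- The shifted regularisation realises at `m` the scheme of `reg` at `M₀ + m`. [folklore] -/
theorem shiftReg_scheme (reg : QCDRegularisation Nf) (M₀ : ℝ) (m : Fin Nf → ℝ)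
    (z shift : QCDField Nf → ℕ → ℝ) :
    (shiftReg reg M₀).scheme m z shift = reg.scheme (fun f => M₀ + m f) z shift := by
  simp only [shiftReg, QCDRegularisation.scheme, QCDScheme.mk.injEq, true_and, and_true]
  funext f k
  ring

/-- **Why S⁺ buys nothing: it is inconsistent with heavy-quark decoupling.**  If ONE honest trajectory
(X₀-body at all positive tuples) carries a UNIFORM lattice rate `ε` above some heavy threshold
`M₀ ≥ 0` — which is what every heavy half (robust Yang–Mills + decoupling) is meant to deliver and what
physics expects (the gap grows with the quark mass) — then its upward `m_crit`-shift is again an honest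
X₀-witness but provably NOT chiral (`Negative.not_isChiralAtZero_mcrit_shift_of_uniformGapAbove`), so
S⁺ fails.  The rigidity therefore has to re-pin `m_crit` by an `∃ δ`, and that statement is the
sibling item `HeavyThresholdYMBridge.ChiralCompletion` (17661) — no new handle. [folklore] -/
theorem not_rigidSupply_of_uniformlyGappedAbove (hNf : Nf = 2 ∨ Nf = 3)
    (reg : QCDRegularisation Nf) (hMS : reg.HasMassScaling) (hbody : X0Body reg)
    {M₀ ε : ℝ} (hM₀ : 0 ≤ M₀) (hε : 0 < ε)
    (hgap : ∀ m : Fin Nf → ℝ, (∀ f, M₀ < m f) → (reg.scheme m 0 0).HasLatticeMassGap ε) :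
    ¬ RigidSupply := by
  intro h
  have hMS' : (shiftReg reg M₀).HasMassScaling :=
    (Negative.hasMassScaling_mcrit_shift_iff reg M₀).mpr hMS
  have hbody' : X0Body (shiftReg reg M₀) := by
    intro m hm
    obtain ⟨z, shift, T, hA, hN, hG, hP⟩ := hbody (fun f => M₀ + m f) (fun f => by linarith [hm f])
    exact ⟨z, shift, T, by rw [shiftReg_scheme]; exact hA, hN, hG, hP⟩
  have hχ' : (shiftReg reg M₀).IsChiralAtZero := (h Nf hNf (shiftReg reg M₀) hMS' hbody').1
  exact Negative.not_isChiralAtZero_mcrit_shift_of_uniformGapAbove reg M₀ hε hgap hχ'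

/-! ## §5 Negation: a counterexample is a construction of X₀ plus a universal non-existence -/

/-- `¬ crux ↔ X₀ ∧ ¬ QCD`. [folklore] -/
theorem not_crux_iff : ¬ RobustYangMillsHandover ↔ ContinuumQCDExists ∧ ¬ _root_.QCD :=
  Classical.not_imp

/-- and `¬ QCD` is a UNIVERSAL statement: for `N_f = 2` or for `N_f = 3`, NO regularisation is at once
mass-scaling, chiral at zero and gapped-with-honest-data at every positive tuple. [folklore] -/
theorem not_qcd_iff :
    ¬ _root_.QCD ↔
      (∀ reg : QCDRegularisation 2, ¬ (reg.HasMassScaling ∧ reg.IsChiralAtZero ∧ QCDBody reg)) ∨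
      (∀ reg : QCDRegularisation 3, ¬ (reg.HasMassScaling ∧ reg.IsChiralAtZero ∧ QCDBody reg)) := by
  have e : ∀ N, QCDOf N ↔ ∃ reg : QCDRegularisation N, reg.HasMassScaling ∧ reg.IsChiralAtZero ∧ QCDBody reg :=
    fun N => Iff.rfl
  constructor
  · intro h
    by_cases h2 : ∃ reg : QCDRegularisation 2, reg.HasMassScaling ∧ reg.IsChiralAtZero ∧ QCDBody reg
    · right
      intro reg hr
      exact h ⟨(e 2).mpr h2, (e 3).mpr ⟨reg, hr⟩⟩
    · left
      intro reg hr
      exact h2 ⟨reg, hr⟩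
  · rintro (h | h) ⟨h2, h3⟩
    · obtain ⟨reg, hr⟩ := (e 2).mp h2
      exact h reg hr
    · obtain ⟨reg, hr⟩ := (e 3).mp h3
      exact h reg hr

end Summit.QuantumFields.QCD.Cruxes.RobustYangMillsHandover.CensusS6
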